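import Summits.FinalStateConjecture.FinalStateConjecture.Theorems.SwallowTheDatumParametricKerrBurialCollarLine
import Summits.FinalStateConjecture.FinalStateConjecture.Theorems.SwallowTheDatumParametricKerrBurialStubTransportPatch
import Summits.FinalStateConjecture.FinalStateConjecture.Theorems.SwallowTheDatumKerrShieldedDataExistStubIsotropicEnd

/-!
# `ParametricKerrBurial`, line `null-shell-shadow-collar` — stub `stub_transportPatchB`
# (crux item stmt-FinalStateConjecture-10052)

The registered stub `stub_transportPatchB` of the second collar line, proved: the `IsCollar`
variant of the first line's `stub_transportPatch`
(`SwallowTheDatumParametricKerrBurialStubTransportPatch.lean`). Given the receding far-gluing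
family `G R` (exact isotropic Schwarzschild(`m R`) beyond chart radius `32R` along the sole end
`e`, jointly smooth in `(R, x)`, `m R ≥ ηR`) and a dilated COLLAR family `Cfam l` on `ℝ³`
(`IsCollar l μ (Cfam l)`: vacuum OUTSIDE the ball of radius `l`, exactly isotropic
Schwarzschild(`M_end`) beyond some radius, isotropic Schwarzschild(`lμ`) on the annulus
`{l < ‖y‖ < 2l}`, Kerr-shielded beyond radius `2l`; jointly smooth in `(l, y)`), set
`l(R) = m R/μ ≥ 32R` and

  `P R := G R` inside / `coord^*(Cfam (l R))` beyond chart radius `5l(R)/4`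

(`AFEnd.annulusPatch`, `AFEndAnnulusPatch.lean`). The only differences with the template are two
local variants of the tree's lemmas on the annulus patch:

* `isVacuumConstraintSolution_annulusPatch_of_vacuumOn` — the patch is vacuum as soon as the
  collar is vacuum on `{l < ‖y‖}`: the tree's proof of `isVacuumConstraintSolution_annulusPatch`
  only evaluates the constraints of `C` at points `coord x` with `‖coord x‖ > 5l/4 > l` (on the
  far region the restriction of the patch IS the pullback of `C` along `coord`,
  `annulusPatch_comap_val_eq`, and the constraints are natural pointwise, `isVacuumAt_comap_iff`);
* `annulusPatch_mem_admissibleVacuumData_of_vacuumOn` — admissibility from that vacuum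
  hypothesis and ANY sole Dafermos–Rodnianski end of `C`; the end of a collar is supplied by
  `stub_isotropicEnd` (`SwallowTheDatumKerrShieldedDataExistStubIsotropicEnd.lean`: a datum on
  `ℝ³` which is exactly `(1 + M/2r)⁴δ`, `k = 0` beyond a ball has the tautological sole end, with
  the decay of `(1 + M/2r)⁴ − (1 + 2M/r) = O₂(r⁻²)`), `exists_end_of_isIsotropicBeyond`.

Everything else (the patch data, the shield read through the chart of the end
`isKerrShielded_of_far_pullback`, agreement off `e.far (32R)`, joint smoothness in `(R, x)`) is
the template verbatim.

References: the route file `Theses/SwallowTheDatum.lean` (item 10052);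
`Cruxes/ParametricKerrBurial/Lines/null-shell-shadow-collar.md`; Corvino 2000, §4; Bartnik 1986,
§1; Bartnik–Isenberg 2004, §2; Dafermos–Rodnianski 2013, App. B.2.3.
-/

-- the doubled `FinalStateConjecture` path component is the summit/problem naming scheme, not a mistake
set_option linter.dupNamespace false

noncomputable section

namespace Summit.FinalStateConjecture.FinalStateConjecture.Theorems.SwallowTheDatum.ParametricKerrBurial

open scoped Manifold ContDiff Topology InnerProductSpace
open Bundle Set Filter Function Metric Literature.Geometry.Lorentzian Literature.Geometry.Manifold

variable {X : Type} [TopologicalSpace X] [ChartedSpace E3 X] [IsManifold (𝓡 3) ∞ X]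

/-! ## §1 The annulus patch by a collar which is vacuum outside a ball -/

section Variants

variable {e : AFEnd X} {D : InitialDataSet (𝓡 3) X} {C : InitialDataSet (𝓡 3) E3} {ρ l M₀ : ℝ}
  (A : AFEnd.AnnulusPatchData e D C ρ l M₀)

/-- **The annulus patch of vacuum data by a collar which is vacuum outside the ball of radius `l`
is vacuum**: off the far region the patch is locally `D`; on it, its restriction is the pullback
of `C` along `coord`, whose values there have norm `> 5l/4 > l`, and the vacuum constraints are
natural pointwise under local diffeomorphisms. Bartnik–Isenberg 2004, §2 (local character and
diffeomorphism equivariance of the constraint map). [cite: BartnikIsenberg2004, §2] -/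
theorem isVacuumConstraintSolution_annulusPatch_of_vacuumOn
    [(AFEnd.annulusPatch A).metric.HasLeviCivita]
    (hD : ∀ [D.metric.HasLeviCivita], D.IsVacuumConstraintSolution)
    (hC : VacuumOn {y | l < ‖y‖} C) : (AFEnd.annulusPatch A).IsVacuumConstraintSolution := by
  haveI : D.metric.HasLeviCivita := D.metric.hasLeviCivita
  haveI : C.metric.HasLeviCivita := C.metric.hasLeviCivita
  intro x
  by_cases hx : x ∈ e.far (5 / 4 * l)
  · -- on the far region: restriction = pullback of `C`, evaluated at `coord x`, `‖coord x‖ > l`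
    set V : TopologicalSpace.Opens X := e.farOpens (5 / 4 * l) with hV
    haveI h1 : ((AFEnd.annulusPatch A).comap (Subtype.val : V → X)
        (InitialDataSet.contMDiff_subtypeVal_succ V)
        (InitialDataSet.injective_mfderiv_subtypeVal V)).metric.HasLeviCivita :=
      PseudoRiemannianMetric.hasLeviCivita _
    haveI h2 : (C.comap (e.coord ∘ (Subtype.val : V → X)) (AFEnd.contMDiff_coord_comp_val (5 / 4 * l))
        (AFEnd.injective_mfderiv_coord_comp_val (5 / 4 * l))).metric.HasLeviCivita :=
      PseudoRiemannianMetric.hasLeviCivita _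
    have hu := (InitialDataSet.isVacuumAt_comap_iff (AFEnd.annulusPatch A)
      (InitialDataSet.contMDiff_subtypeVal_succ V) (InitialDataSet.injective_mfderiv_subtypeVal V)
      ⟨x, hx⟩).1
    apply hu
    -- the constraints of `C` vanish at `coord x`
    obtain ⟨-, hgt⟩ := e.mem_far_iff_coord.1 hx
    have hmem : e.coord x ∈ {y : E3 | l < ‖y‖} := by
      change l < ‖e.coord x‖
      linarith [A.l_pos]
    have hCx : C.hamiltonianConstraintFn (e.coord x) = 0 ∧ C.momentumConstraintFn (e.coord x) = 0 :=
      hC (e.coord x) hmem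
    have hcomap := (InitialDataSet.isVacuumAt_comap_iff C (AFEnd.contMDiff_coord_comp_val (5 / 4 * l))
      (AFEnd.injective_mfderiv_coord_comp_val (5 / 4 * l)) (⟨x, hx⟩ : V)).2 hCx
    have key : ∀ (A' B' : InitialDataSet (𝓡 3) V) [A'.metric.HasLeviCivita] [B'.metric.HasLeviCivita],
        A' = B' → (B'.hamiltonianConstraintFn ⟨x, hx⟩ = 0 ∧ B'.momentumConstraintFn ⟨x, hx⟩ = 0) →
          (A'.hamiltonianConstraintFn ⟨x, hx⟩ = 0 ∧ A'.momentumConstraintFn ⟨x, hx⟩ = 0) := by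
      rintro A' B' _ _ rfl hB
      exact hB
    exact key _ _ (AFEnd.annulusPatch_comap_val_eq A) hcomap
  · -- off the far region: locally `D`
    have hR' : e.R < 3 / 2 * l := by linarith [A.R_le, A.le_l, A.l_pos]
    have hx' : x ∉ e.closedFar (3 / 2 * l) :=
      e.notMem_closedFar_of_notMem_far (by linarith [A.l_pos]) hx
    obtain ⟨hh, hk⟩ := AFEnd.patch_eventuallyEq_of_not_mem_closedFar (AFEnd.annulusPatchData A) hR'
      (by linarith [A.l_pos]) hx'
    exact (InitialDataSet.isVacuumAt_congr hh hk).2 (hD x)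

/-- **The end clauses of a datum on `ℝ³` which is exactly isotropic Schwarzschild beyond a ball**:
if `C` is `(1 + M/2r)⁴ δ`, `k = 0` beyond radius `R_end > 0` (`M ≥ 0`), then `ℝ³` carries a sole
asymptotically flat end along which `C` is Dafermos–Rodnianski strongly asymptotically flat with
mass `M` (`stub_isotropicEnd`: the tautological end, decay of `(1 + M/2r)⁴ − (1 + 2M/r)`).
Misner–Thorne–Wheeler 1973, (31.22); Dafermos–Rodnianski 2013, App. B.2.3.
[cite: DafermosRodnianski2013, App. B.2.3] -/
theorem exists_end_of_isIsotropicBeyond {C : InitialDataSet (𝓡 3) E3} {Mend Rend : ℝ}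
    (hMend : 0 ≤ Mend) (hRend : 0 < Rend) (hiso : IsIsotropicBeyond Mend Rend C) :
    ∃ f : AFEnd E3, f.IsSoleEnd ∧ f.IsStronglyAsymptoticallyFlatDR C Mend :=
  stub_isotropicEnd C Mend Rend hMend hRend fun y hy ↦
    ⟨fun v w ↦ by rw [(hiso y hy).1]; rfl, (hiso y hy).2⟩

variable [T2Space X] [SecondCountableTopology X] [ConnectedSpace X]

/-- **The annulus patch of vacuum data with a sole end by a collar which is vacuum outside the
ball of radius `l` and has a sole Dafermos–Rodnianski end is admissible**: vacuum by
`isVacuumConstraintSolution_annulusPatch_of_vacuumOn`; its end is the transplanted far end of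
`C` (sole, `isSoleEnd_transplant`; decay, `isStronglyAsymptoticallyFlatDR_annulusPatch`);
complete because one-ended asymptotically flat data are (`isComplete_of_isSoleEnd_holds`).
Christodoulou 1999, p. A24 (the admissible class). [cite: Christodoulou1999, p. A24] -/
theorem annulusPatch_mem_admissibleVacuumData_of_vacuumOn (he : e.IsSoleEnd)
    (hD : ∀ [D.metric.HasLeviCivita], D.IsVacuumConstraintSolution)
    (hCvac : VacuumOn {y | l < ‖y‖} C) {f : AFEnd E3} {M₁ : ℝ} (hfsole : f.IsSoleEnd)
    (hfdecay : f.IsStronglyAsymptoticallyFlatDR C M₁) :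
    AFEnd.annulusPatch A ∈ admissibleVacuumData X := by
  obtain ⟨ρ₀, ρ₁, hρ₀, T⟩ := AFEnd.exists_transplantData A f
  have hdecay := AFEnd.isStronglyAsymptoticallyFlatDR_annulusPatch A hρ₀ T hfdecay
  have hsole : (AFEnd.transplant T).IsSoleEnd :=
    AFEnd.isSoleEnd_transplant T he (AFEnd.exists_forall_mem_far_of_isSoleEnd hfsole)
  refine ⟨?_, AFEnd.transplant T, M₁, hsole, hdecay⟩
  intro inst
  exact ⟨isVacuumConstraintSolution_annulusPatch_of_vacuumOn A hD hCvac,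
    isComplete_of_isSoleEnd_holds X (AFEnd.annulusPatch A) (AFEnd.transplant T) M₁ 1 2 2 1
      zero_le_one hdecay hsole⟩

end Variants

/-! ## §2 The stub -/

/-- **Stub `stub_transportPatchB`** (registered signature, line `null-shell-shadow-collar`, crux
item stmt-FinalStateConjecture-10052): patch the receding far-gluing family with the dilated
collar family across the isotropic Schwarzschild annulus, `l(R) = m R/μ`; the collar need only be
vacuum outside the ball of radius `l` (discarded by the patch) and its end is read off its exact
isotropic Schwarzschild far region. Corvino 2000, §4; Bartnik 1986, §1. [folklore] -/
theorem stub_transportPatchB : ∀ [Kerr.Facts] (X : Type) [TopologicalSpace X] [ChartedSpace E3 X]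
    [IsManifold (𝓡 3) ∞ X] [T2Space X] [SecondCountableTopology X] [ConnectedSpace X] (e : AFEnd X)
    (Rstar η μ : ℝ) (m : ℝ → ℝ) (G : ℝ → InitialDataSet (𝓡 3) X) (Cfam : ℝ → InitialDataSet (𝓡 3) E3),
    e.IsSoleEnd → e.R < Rstar → 0 < μ → 32 * μ ≤ η → ContDiff ℝ ∞ m →
    SmoothSectionsOn 𝓘(ℝ, ℝ) G {p : ℝ × X | Rstar < p.1} →
    (∀ R : ℝ, Rstar < R → G R ∈ admissibleVacuumData X ∧ η * R ≤ m R ∧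
      IsExactSchwarzschildBeyond e (G R) (m R) (32 * R)) →
    SmoothSectionsOn 𝓘(ℝ, ℝ) Cfam {p : ℝ × E3 | 0 < p.1} →
    (∀ l : ℝ, 0 < l → IsCollar l μ (Cfam l)) →
    ∃ P : ℝ → InitialDataSet (𝓡 3) X, SmoothSectionsOn 𝓘(ℝ, ℝ) P {p : ℝ × X | Rstar < p.1} ∧
      ∀ R : ℝ, Rstar < R → P R ∈ admissibleVacuumData X ∧ IsKerrShielded X (P R) ∧
        ∀ x ∉ e.far (32 * R), AgreeAt (P R) (G R) x := by
  intro _ X _ _ _ _ _ _ e Rstar η μ m G Cfam he heR hμ h32 hm hGs hG hCs hC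
  classical
  -- the collar scale `l(R) = m R / μ ≥ 32 R`
  let l : ℝ → ℝ := fun R ↦ m R / μ
  have hlμ : ∀ R, l R * μ = m R := fun R ↦ div_mul_cancel₀ (m R) hμ.ne'
  have hl32 : ∀ {R : ℝ}, Rstar < R → 32 * R ≤ l R := by
    intro R hR
    have h1 := (hG R hR).2.1
    rw [le_div_iff₀ hμ]
    nlinarith [e.R_pos]
  have hRpos : ∀ {R : ℝ}, Rstar < R → 0 < R := fun hR ↦ by linarith [e.R_pos]
  have hlpos : ∀ {R : ℝ}, Rstar < R → 0 < l R := fun hR ↦ by linarith [hl32 hR, hRpos hR]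
  have hlcont : Continuous l := (hm.continuous).div_const μ
  -- the annulus patch data at each radius
  have hA : ∀ {R : ℝ}, Rstar < R → AFEnd.AnnulusPatchData e (G R) (Cfam (l R)) (32 * R) (l R) (m R) := by
    intro R hR
    refine ⟨by linarith [hRpos hR], hl32 hR, hlpos hR, (hG R hR).2.2, fun y h1 h2 ↦ ?_⟩
    have h := ((hC (l R) (hlpos hR)).2.2.1 y h1 h2)
    rwa [hlμ R] at h
  -- the family
  let P : ℝ → InitialDataSet (𝓡 3) X := fun R ↦
    if h : Rstar < R then AFEnd.annulusPatch (hA h) else G R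
  have hP : ∀ {R : ℝ} (h : Rstar < R), P R = AFEnd.annulusPatch (hA h) := fun h ↦ dif_pos h
  -- pointwise values of the sections of `P`
  have hPfar : ∀ {R : ℝ} (h : Rstar < R) {x : X}, x ∈ e.far (5 / 4 * l R) →
      (P R).h.inner x = AFEnd.outerField e ((Cfam (l R)).coordH) x ∧
        (P R).k x = AFEnd.outerField e ((Cfam (l R)).coordK) x := by
    intro R h x hx
    rw [hP h]
    exact AFEnd.annulusPatch_eq_of_mem_far (hA h) hx
  have hPin : ∀ {R : ℝ} (h : Rstar < R) {x : X}, x ∉ e.closedFar (7 / 4 * l R) →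
      (P R).h.inner x = (G R).h.inner x ∧ (P R).k x = (G R).k x := by
    intro R h x hx
    rw [hP h]
    exact ⟨AFEnd.patch_h_inner_of_not_mem_closedFar (AFEnd.annulusPatchData (hA h)) hx,
      AFEnd.patch_k_of_not_mem_closedFar (AFEnd.annulusPatchData (hA h)) hx⟩
  refine ⟨P, ?_, fun R hR ↦ ⟨?_, ?_, fun x hx ↦ ?_⟩⟩
  · /- joint smoothness on `{R⋆ < R}`: near `(R, x)` with `x` inside, `P = G` on a product
      neighbourhood; with `x` far out, `P` is the outer family. -/
    -- the collar family as a smooth matrix-valued function of `(l, z)`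
    have hopenE : IsOpen {p : ℝ × E3 | 0 < p.1} := isOpen_lt continuous_const continuous_fst
    have hCh : ContMDiffOn (𝓘(ℝ, ℝ).prod 𝓘(ℝ, E3)) 𝓘(ℝ, E3 →L[ℝ] E3 →L[ℝ] ℝ) ∞
        (fun p : ℝ × E3 ↦ (Cfam p.1).coordH p.2) {p : ℝ × E3 | 0 < p.1} :=
      ((contMDiffOn_bilinSection_model_iff (IQ := 𝓘(ℝ, ℝ).prod 𝓘(ℝ, E3)) (b := fun p : ℝ × E3 ↦ p.2)
        (s := fun p : ℝ × E3 ↦ (Cfam p.1).coordH p.2) hopenE).1 hCs.1).2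
    have hCk : ContMDiffOn (𝓘(ℝ, ℝ).prod 𝓘(ℝ, E3)) 𝓘(ℝ, E3 →L[ℝ] E3 →L[ℝ] ℝ) ∞
        (fun p : ℝ × E3 ↦ (Cfam p.1).coordK p.2) {p : ℝ × E3 | 0 < p.1} :=
      ((contMDiffOn_bilinSection_model_iff (IQ := 𝓘(ℝ, ℝ).prod 𝓘(ℝ, E3)) (b := fun p : ℝ × E3 ↦ p.2)
        (s := fun p : ℝ × E3 ↦ (Cfam p.1).coordK p.2) hopenE).1 hCs.2).2
    have hopen : IsOpen {p : ℝ × X | Rstar < p.1} := isOpen_lt continuous_const continuous_fst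
    -- generic argument for one of the two sections
    have key : ∀ (secP secG : Π q : ℝ × X, TangentSpace (𝓡 3) q.2 →L[ℝ] TangentSpace (𝓡 3) q.2 →L[ℝ] ℝ)
        (fld : InitialDataSet (𝓡 3) E3 → E3 → E3 →L[ℝ] E3 →L[ℝ] ℝ),
        ContMDiffOn (𝓘(ℝ, ℝ).prod (𝓡 3)) ((𝓡 3).prod 𝓘(ℝ, E3 →L[ℝ] E3 →L[ℝ] ℝ)) ∞
          (fun q : ℝ × X ↦ TotalSpace.mk' (E3 →L[ℝ] E3 →L[ℝ] ℝ)
            (E := fun x : X ↦ TangentSpace (𝓡 3) x →L[ℝ] TangentSpace (𝓡 3) x →L[ℝ] ℝ) q.2 (secG q))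
          {p : ℝ × X | Rstar < p.1} →
        ContMDiffOn (𝓘(ℝ, ℝ).prod 𝓘(ℝ, E3)) 𝓘(ℝ, E3 →L[ℝ] E3 →L[ℝ] ℝ) ∞
          (fun p : ℝ × E3 ↦ fld (Cfam p.1) p.2) {p : ℝ × E3 | 0 < p.1} →
        (∀ q : ℝ × X, Rstar < q.1 → q.2 ∈ e.far (5 / 4 * l q.1) →
          secP q = AFEnd.outerField e (fld (Cfam (l q.1))) q.2) →
        (∀ q : ℝ × X, Rstar < q.1 → q.2 ∉ e.closedFar (7 / 4 * l q.1) → secP q = secG q) →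
        ContMDiffOn (𝓘(ℝ, ℝ).prod (𝓡 3)) ((𝓡 3).prod 𝓘(ℝ, E3 →L[ℝ] E3 →L[ℝ] ℝ)) ∞
          (fun q : ℝ × X ↦ TotalSpace.mk' (E3 →L[ℝ] E3 →L[ℝ] ℝ)
            (E := fun x : X ↦ TangentSpace (𝓡 3) x →L[ℝ] TangentSpace (𝓡 3) x →L[ℝ] ℝ) q.2 (secP q))
          {p : ℝ × X | Rstar < p.1} := by
      intro secP secG fld hGsec hfld hfar hin q hq
      obtain ⟨R, x⟩ := q
      have hR : Rstar < R := hq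
      apply ContMDiffAt.contMDiffWithinAt
      -- a neighbourhood of `R` on which `l` moves by less than `l R / 8`
      have hl8 : 0 < l R / 8 := by linarith [hlpos hR]
      obtain ⟨δ, hδ, hδl⟩ := Metric.continuousAt_iff.1 hlcont.continuousAt (l R / 8) hl8
      set N : Set ℝ := ball R δ ∩ Ioi Rstar with hN
      have hNopen : IsOpen N := isOpen_ball.inter isOpen_Ioi
      have hRN : R ∈ N := ⟨mem_ball_self hδ, hR⟩
      have hNl : ∀ R' ∈ N, |l R' - l R| < l R / 8 := fun R' hR' ↦ by
        have h := hδl hR'.1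
        rwa [Real.dist_eq] at h
      set ρ' : ℝ := 3 / 2 * l R with hρ'
      by_cases hx : x ∈ e.closedFar ρ'
      · -- far out: `P = ` the outer family on `N × far (45/32 · l R)`
        obtain ⟨hxU, hxρ⟩ := hx
        have hxfar : x ∈ e.far (45 / 32 * l R) :=
          e.mem_far_iff_coord.2 ⟨hxU, by linarith [hlpos hR]⟩
        -- the outer family is smooth at `(R, x)`
        have hc : ContMDiffAt (𝓘(ℝ, ℝ).prod 𝓘(ℝ, E3)) 𝓘(ℝ, E3 →L[ℝ] E3 →L[ℝ] ℝ) ∞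
            (uncurry fun (R' : ℝ) (z : E3) ↦ fld (Cfam (l R')) z) (R, e.coord x) := by
          have h1 : ContMDiffAt (𝓘(ℝ, ℝ).prod 𝓘(ℝ, E3)) 𝓘(ℝ, E3 →L[ℝ] E3 →L[ℝ] ℝ) ∞
              (fun p : ℝ × E3 ↦ fld (Cfam p.1) p.2) (l R, e.coord x) :=
            (hfld _ (hlpos hR)).contMDiffAt (hopenE.mem_nhds (hlpos hR))
          have h2 : ContMDiffAt (𝓘(ℝ, ℝ).prod 𝓘(ℝ, E3)) (𝓘(ℝ, ℝ).prod 𝓘(ℝ, E3)) ∞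
              (fun p : ℝ × E3 ↦ (l p.1, p.2)) (R, e.coord x) :=
            ((hm.div_const μ).contMDiff.contMDiffAt.comp _ contMDiffAt_fst).prodMk contMDiffAt_snd
          exact h1.comp (R, e.coord x) h2
        have hsm := e.contMDiffAt_outerField_family (IP := 𝓘(ℝ, ℝ)) (c := fun (R' : ℝ) (z : E3) ↦ fld (Cfam (l R')) z)
          hxU hc
        refine hsm.congr_of_eventuallyEq ?_
        have hev : ∀ᶠ q : ℝ × X in 𝓝 (R, x), q.1 ∈ N ∧ q.2 ∈ e.far (45 / 32 * l R) :=
          prod_mem_nhds (hNopen.mem_nhds hRN) ((e.isOpen_far _).mem_nhds hxfar)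
        filter_upwards [hev] with q hq
        have hq1 : Rstar < q.1 := hq.1.2
        have hql := abs_lt.1 (hNl q.1 hq.1)
        have hq2 : q.2 ∈ e.far (5 / 4 * l q.1) := by
          refine e.far_mono ?_ hq.2
          linarith
        rw [hfar q hq1 hq2]
      · -- inside: `P = G` on `N × (closedFar ρ')ᶜ`
        have hρ'R : e.R < ρ' := by
          have := hl32 hR; have := hRpos hR; rw [hρ']; linarith [heR, e.R_pos]
        have hGat : ContMDiffAt (𝓘(ℝ, ℝ).prod (𝓡 3)) ((𝓡 3).prod 𝓘(ℝ, E3 →L[ℝ] E3 →L[ℝ] ℝ)) ∞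
            (fun q : ℝ × X ↦ TotalSpace.mk' (E3 →L[ℝ] E3 →L[ℝ] ℝ)
              (E := fun x : X ↦ TangentSpace (𝓡 3) x →L[ℝ] TangentSpace (𝓡 3) x →L[ℝ] ℝ) q.2 (secG q)) (R, x) :=
          (hGsec _ hR).contMDiffAt (hopen.mem_nhds hR)
        refine hGat.congr_of_eventuallyEq ?_
        have hev : ∀ᶠ q : ℝ × X in 𝓝 (R, x), q.1 ∈ N ∧ q.2 ∉ e.closedFar ρ' :=
          prod_mem_nhds (hNopen.mem_nhds hRN) ((e.isClosed_closedFar hρ'R).isOpen_compl.mem_nhds hx)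
        filter_upwards [hev] with q hq
        have hq1 : Rstar < q.1 := hq.1.2
        have hql := abs_lt.1 (hNl q.1 hq.1)
        have hq2 : q.2 ∉ e.closedFar (7 / 4 * l q.1) := by
          intro hmem
          obtain ⟨hU, hle⟩ := hmem
          exact hq.2 ⟨hU, by linarith⟩
        rw [hin q hq1 hq2]
    refine ⟨key (fun q ↦ (P q.1).h.inner q.2) (fun q ↦ (G q.1).h.inner q.2) InitialDataSet.coordH hGs.1 hCh
        (fun q h hx ↦ (hPfar h hx).1) (fun q h hx ↦ (hPin h hx).1),
      key (fun q ↦ (P q.1).k q.2) (fun q ↦ (G q.1).k q.2) InitialDataSet.coordK hGs.2 hCk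
        (fun q h hx ↦ (hPfar h hx).2) (fun q h hx ↦ (hPin h hx).2)⟩
  · -- admissibility: vacuum outside the ball of radius `l R` suffices; the end of the collar
    rw [hP hR]
    obtain ⟨hGadm, -, -⟩ := hG R hR
    have hGvac : ∀ [(G R).metric.HasLeviCivita], (G R).IsVacuumConstraintSolution := fun {inst} ↦ (hGadm.1).1
    obtain ⟨hCvac, ⟨Mend, Rend, hMend, hRend, hiso⟩, -, -⟩ := hC (l R) (hlpos hR)
    obtain ⟨f, hfsole, hfdecay⟩ := exists_end_of_isIsotropicBeyond hMend hRend hiso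
    exact annulusPatch_mem_admissibleVacuumData_of_vacuumOn (hA hR) he hGvac hCvac hfsole hfdecay
  · -- shielding, read through the chart of the end
    have h54 : e.R ≤ 5 / 4 * l R := by linarith [hl32 hR, hRpos hR, heR]
    refine isKerrShielded_of_far_pullback e he (P R) (Cfam (l R)) h54 (by linarith [hlpos hR])
      (fun x hx ↦ (hPfar hR hx).1) (fun x hx ↦ (hPfar hR hx).2) (hC (l R) (hlpos hR)).2.2.2
  · -- agreement with `G R` off `e.far (32 R)`
    have hx' : x ∉ e.far (5 / 4 * l R) := fun h ↦ hx (e.far_mono (by linarith [hl32 hR, hRpos hR]) h)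
    rw [hP hR]
    exact AFEnd.annulusPatch_eq_of_not_mem_far (hA hR) hx'

end Summit.FinalStateConjecture.FinalStateConjecture.Theorems.SwallowTheDatum.ParametricKerrBurial

end
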